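import Literature.Analysis.FluidPDE.DissipationAnomaly
import Literature.Analysis.FluidPDE.SphereIntegral
import Literature.Analysis.FunctionSpaces.FlatTorusProofs
import Literature.Analysis.FunctionSpaces.TorusSpaceTime
import HarnessLib

/-!
# Shell averages of velocity increments and the conditional 4/3 law (proofs)

Topic: Analysis/FluidPDE, proofs about the notions of
`Literature.Analysis.FluidPDE.DissipationAnomaly` (Duchon–Robert flux
`Torus.duchonRobertApprox`, defect `Torus.HasDuchonRobertDefect`, sphere-averaged fluxes
`Torus.energyFluxSphereAvg`, the predicate `Torus.HasFourThirdsLaw`).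

## Main result

`Torus.HasDuchonRobertDefect.eq_of_tendsto_energyFlux`: in any dimension `d ≥ 1`, if
`u ∈ L³((0,T) × T^d)` (jointly measurable) has Duchon–Robert defect `D`, `ψ` is a test function
supported in `(0,T) × T^d`, and the shell pairing
`G(ℓ) = ∫₀ᵀ∫ ℓ⁻¹ ⨍_{S^{d-1}} (δu(t,x;ℓω)·ω) |δu(t,x;ℓω)|² dω ψ(t,x) dx dt` converges to `S ψ` as
`ℓ → 0⁺`, then `S ψ = −(4/d) · D ψ` — the **conditional 4/3 law** exactly as printed by
Duchon–Robert 2000, §5 and Eyink 2003, §1, (1.5)–(1.7) ("assuming that the following limit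
exists … `S(u) = −(4/3) D(u)`"), here without the Euler equation (it is not needed: the defect is
*defined* as the limit of the Duchon–Robert fluxes, DissipationAnomaly's `HasDuchonRobertDefect`)
and in general dimension. Corollary `Torus.HasDuchonRobertDefect.hasFourThirdsLaw_of_tendsto`:
if the shell limits exist for every test function, `Torus.HasFourThirdsLaw T u D` holds.

## Proof architecture (Duchon–Robert 2000, §5; Eyink 2003, proof of Cor. 1)

For a *spherically symmetric* mollifier `φ` with profile `Φ` (`φ(ξ) = Φ(|ξ|)`; such mollifiers
exist, `Torus.exists_isMollifier_radial`), `∇φ^ε(ξ) = ε^{-d} ε⁻¹ Φ'(|ξ|/ε) ξ̂`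
(`Torus.inner_gradient_mollifierScale`), so the Duchon–Robert flux paired with `ψ` is, by Fubini
on `((0,T) × T^d) × ℝ^d` and polar coordinates in `ξ` (`Torus.integral_kernel_increment_eq_polar`,
resting on `Literature.Analysis.FluidPDE.integral_eq_integral_Ioi_sphereIntegral`),
`∫∫ D_ε(u) ψ = ¼ |S^{d-1}| ∫_{r>0} r^{d-1} ε^{-d-1} Φ'(r/ε) · r G(r) dr = ¼ |S^{d-1}| ∫_{x>0} x^d Φ'(x) G(εx) dx`.
As `ε → 0⁺` the left side tends to `D ψ` (definition of the defect) and the right side, by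
dominated convergence (`Torus.tendsto_integral_Ioi_mul_comp_mul`; `G` is measurable in the scale,
`Torus.aestronglyMeasurable_integral_sphereAvg`, and bounded near `0` since it converges), to
`¼ |S^{d-1}| (∫ x^d Φ') S ψ = −(d/4) (|S^{d-1}| ∫ x^{d-1} Φ) S ψ = −(d/4) S ψ`
(integration by parts `Torus.integral_Ioi_pow_mul_deriv` and unit mass
`Torus.toSphere_real_univ_mul_integral_profile`). Hence `S ψ = −(4/d) D ψ`.

The measure-theoretic backbone (translation invariance of Haar measure on `T^d`):
`Torus.quasiMeasurePreserving_translate`, `Torus.lintegral_mul_translate_enorm_pow`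
(`∫∫∫ w(b) |u(t, x + a(b))|³ = (∫ w) ‖u‖₃³`), whence the integrability statements
`Torus.integrable_kernel_increment` (`|Q(ω,v)| ≤ C|v|³`, `k(|·|) ∈ L¹(ℝ^d)`) and
`Torus.integrable_sphere_increment`; the kernel/shell identity is stated for a general cubic form
`Q(ω, δu)` so that it also serves the longitudinal and mixed fluxes of Eyink's 4/5 law.

## References

* J. Duchon, R. Robert, *Inertial energy dissipation for weak solutions of incompressible Euler
  and Navier–Stokes equations*, Nonlinearity 13 (2000) 249–255, §5 (the 4/3 law under the
  hypothesis that the shell limit exists). [DuchonRobert2000]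
* G. L. Eyink, *Local 4/5-law and energy dissipation anomaly in turbulence*, Nonlinearity 16
  (2003) 137–145 (arXiv:nlin/0208004), §1 (1.5)–(1.7), §2 proof of Cor. 1 (polar coordinates).
  [Eyink2003]
* Mathlib: `MeasureTheory.integral_fun_norm_addHaar`, `Measure.toSphere`,
  `MeasureTheory.tendsto_integral_filter_of_dominated_convergence`.
-/

noncomputable section

open MeasureTheory MeasureTheory.Measure TopologicalSpace Set Function Filter Topology Metric Module
open scoped InnerProductSpace RealInnerProductSpace ENNReal NNReal

namespace Literature.Analysis.FluidPDE.Torus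

variable {d : Type*} [Fintype d]

/-! ## Measurability of translated fields -/

section Translate

variable {β : Type*} [MeasurableSpace β]

/-- Translating the space variable by a measurable family of shifts is quasi measure preserving
from `(μ ⊗ vol_{T^d}) ⊗ ν` to `μ ⊗ vol_{T^d}` (each section is measure preserving). [folklore] -/
theorem quasiMeasurePreserving_translate (μ : Measure ℝ) [SFinite μ] (ν : Measure β) [SFinite ν]
    {a : β → UnitAddTorus d} (ha : Measurable a) :
    QuasiMeasurePreserving (fun q : (ℝ × UnitAddTorus d) × β => (q.1.1, q.1.2 + a q.2))
      ((μ.prod volume).prod ν) (μ.prod volume) := by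
  refine QuasiMeasurePreserving.prod_of_left (by fun_prop) (ae_of_all _ fun b => ?_)
  have h : MeasurePreserving (Prod.map id fun x : UnitAddTorus d => x + a b)
      (μ.prod volume) (μ.prod volume) :=
    (MeasurePreserving.id μ).prod (measurePreserving_add_right volume (a b))
  exact h.quasiMeasurePreserving

/-- If `uncurry u` is a.e.-strongly measurable on `μ ⊗ vol`, then so is
`((t, x), b) ↦ u t (x + a b)` on `(μ ⊗ vol) ⊗ ν`. [folklore] -/
theorem aestronglyMeasurable_translate {F : Type*} [TopologicalSpace F]
    {μ : Measure ℝ} [SFinite μ] {ν : Measure β} [SFinite ν]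
    {u : ℝ → UnitAddTorus d → F} (hu : AEStronglyMeasurable (uncurry u) (μ.prod volume))
    {a : β → UnitAddTorus d} (ha : Measurable a) :
    AEStronglyMeasurable (fun q : (ℝ × UnitAddTorus d) × β => u q.1.1 (q.1.2 + a q.2))
      ((μ.prod volume).prod ν) :=
  hu.comp_quasiMeasurePreserving (quasiMeasurePreserving_translate μ ν ha)

/-- Weighted Tonelli for translated fields:
`∫⁻ ((t,x),b) w b * ‖u t (x + a b)‖ₑ^n = (∫⁻ w) * ∫⁻ (t,x) ‖u t x‖ₑ^n`. [folklore] -/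
theorem lintegral_mul_translate_enorm_pow {F : Type*} [NormedAddCommGroup F]
    {μ : Measure ℝ} [SFinite μ] {ν : Measure β} [SFinite ν]
    {u : ℝ → UnitAddTorus d → F} (hu : AEStronglyMeasurable (uncurry u) (μ.prod volume))
    {a : β → UnitAddTorus d} (ha : Measurable a) {w : β → ℝ≥0∞} (hw : AEMeasurable w ν) (n : ℕ) :
    ∫⁻ q, w q.2 * ‖u q.1.1 (q.1.2 + a q.2)‖ₑ ^ n ∂((μ.prod volume).prod ν) =
      (∫⁻ b, w b ∂ν) * ∫⁻ p, ‖uncurry u p‖ₑ ^ n ∂(μ.prod volume) := by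
  have hmeas : AEMeasurable (fun q : (ℝ × UnitAddTorus d) × β => w q.2 * ‖u q.1.1 (q.1.2 + a q.2)‖ₑ ^ n)
      ((μ.prod volume).prod ν) :=
    (hw.comp_quasiMeasurePreserving quasiMeasurePreserving_snd).mul
      ((aestronglyMeasurable_translate hu ha).enorm.pow_const n)
  rw [lintegral_prod_symm _ hmeas]
  have hsec : ∀ b, ∫⁻ p, w b * ‖u p.1 (p.2 + a b)‖ₑ ^ n ∂(μ.prod volume) =
      w b * ∫⁻ p, ‖uncurry u p‖ₑ ^ n ∂(μ.prod volume) := fun b => by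
    have h : MeasurePreserving (Prod.map id fun x : UnitAddTorus d => x + a b)
        (μ.prod volume) (μ.prod volume) :=
      (MeasurePreserving.id μ).prod (measurePreserving_add_right volume (a b))
    have hemb : MeasurableEmbedding (Prod.map id fun x : UnitAddTorus d => x + a b) :=
      (MeasurableEquiv.prodCongr (MeasurableEquiv.refl ℝ)
        (MeasurableEquiv.addRight (a b))).measurableEmbedding
    have := h.lintegral_comp_emb hemb (fun p => w b * ‖uncurry u p‖ₑ ^ n)
    rw [lintegral_const_mul'' _ (hu.enorm.pow_const n)] at this
    exact this
  simp only [hsec]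
  rw [lintegral_mul_const'' _ hw]

end Translate

/-! ## Cubes of norms -/

/-- `(a + b)³ ≤ 4 (a³ + b³)` for `a, b ≥ 0`. [folklore] -/
theorem add_pow_three_le {a b : ℝ} (ha : 0 ≤ a) (hb : 0 ≤ b) :
    (a + b) ^ 3 ≤ 4 * (a ^ 3 + b ^ 3) := by
  nlinarith [sq_nonneg (a - b), mul_nonneg ha hb, sq_nonneg (a + b)]

/-- `‖v − w‖³ ≤ 4 (‖v‖³ + ‖w‖³)`. [folklore] -/
theorem norm_sub_pow_three_le {F : Type*} [NormedAddCommGroup F] (v w : F) :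
    ‖v - w‖ ^ 3 ≤ 4 * (‖v‖ ^ 3 + ‖w‖ ^ 3) :=
  (pow_le_pow_left₀ (norm_nonneg _) (norm_sub_le v w) 3).trans
    (add_pow_three_le (norm_nonneg _) (norm_nonneg _))

/-- `‖ ‖v‖ⁿ ‖ₑ = ‖v‖ₑⁿ`. [folklore] -/
theorem enorm_norm_pow {F : Type*} [NormedAddCommGroup F] (v : F) (n : ℕ) :
    ‖‖v‖ ^ n‖ₑ = ‖v‖ₑ ^ n := by
  rw [Real.enorm_eq_ofReal (pow_nonneg (norm_nonneg _) _), ENNReal.ofReal_pow (norm_nonneg _),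
    ofReal_norm]

/-- An `L³` field has integrable cubed norm. [folklore] -/
theorem integrable_norm_pow_three {α F : Type*} [MeasurableSpace α] [NormedAddCommGroup F]
    {μ : Measure α} {f : α → F} (hf : AEStronglyMeasurable f μ) (h3 : ∫⁻ a, ‖f a‖ₑ ^ 3 ∂μ < ∞) :
    Integrable (fun a => ‖f a‖ ^ 3) μ :=
  ⟨(hf.norm.pow 3), by
    simp only [HasFiniteIntegral, enorm_norm_pow]
    exact h3⟩

/-! ## Sphere averages versus sphere integrals -/

section Sphere

/-- `∫_{S^{d-1}} h dσ = σ(S^{d-1}) · ⨍ h` for the surface measure `σ = volume.toSphere`. [folklore] -/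
theorem integral_sphere_eq_mul_sphereAvg (h : EuclideanSpace ℝ d → ℝ) :
    ∫ ω, h ω ∂(volume : Measure (EuclideanSpace ℝ d)).toSphere =
      (volume : Measure (EuclideanSpace ℝ d)).toSphere.real univ * sphereAvg h := by
  rw [sphereAvg, average_eq, smul_eq_mul]
  by_cases hc : (volume : Measure (EuclideanSpace ℝ d)).toSphere.real univ = 0
  · have h0 : (volume : Measure (EuclideanSpace ℝ d)).toSphere = 0 := by
      rw [measureReal_def, ENNReal.toReal_eq_zero_iff] at hc
      exact Measure.measure_univ_eq_zero.1 (hc.resolve_right (measure_ne_top _ _))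
    simp [h0]
  · rw [← mul_assoc, mul_inv_cancel₀ hc, one_mul]

end Sphere


/-! ## The kernel/shell identity -/

section Shell

variable {T : ℝ} {u : ℝ → UnitAddTorus d → EuclideanSpace ℝ d} {ψ : ℝ → UnitAddTorus d → ℝ}
  {Q : EuclideanSpace ℝ d → EuclideanSpace ℝ d → ℝ} {CQ Cψ : ℝ} {k : ℝ → ℝ}

/-- The direction map `ξ ↦ ξ/|ξ|` is measurable. [folklore] -/
theorem measurable_unitDir :
    Measurable fun ξ : EuclideanSpace ℝ d => ‖ξ‖⁻¹ • ξ :=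
  measurable_norm.inv.smul measurable_id

/-- `‖ξ/|ξ|‖ ≤ 1`. [folklore] -/
theorem norm_unitDir_le (ξ : EuclideanSpace ℝ d) : ‖‖ξ‖⁻¹ • ξ‖ ≤ 1 := by
  rw [norm_smul, norm_inv, norm_norm]
  by_cases h : ‖ξ‖ = 0
  · simp [h]
  · rw [inv_mul_cancel₀ h]

/-- Joint measurability of the increment `((t,x), ξ) ↦ δu(t,x;ξ)`. [folklore] -/
theorem aestronglyMeasurable_increment
    (hu : AEStronglyMeasurable (uncurry u) ((volume.restrict (Ioo 0 T)).prod volume)) :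
    AEStronglyMeasurable
      (fun q : (ℝ × UnitAddTorus d) × EuclideanSpace ℝ d => increment (u q.1.1) q.2 q.1.2)
      (((volume.restrict (Ioo 0 T)).prod volume).prod volume) := by
  have h : (fun q : (ℝ × UnitAddTorus d) × EuclideanSpace ℝ d => increment (u q.1.1) q.2 q.1.2) =
      fun q => u q.1.1 (q.1.2 + FunctionSpaces.Torus.proj q.2) - uncurry u q.1 := by
    funext q; rfl
  rw [h]
  exact (aestronglyMeasurable_translate (ν := volume) hu FunctionSpaces.Torus.measurable_proj).sub hu.comp_fst

/-- Joint measurability of the increment at separation `r ω`, `ω` on the unit sphere. [folklore] -/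
theorem aestronglyMeasurable_increment_sphere
    (hu : AEStronglyMeasurable (uncurry u) ((volume.restrict (Ioo 0 T)).prod volume)) (r : ℝ) :
    AEStronglyMeasurable
      (fun q : (ℝ × UnitAddTorus d) × sphere (0 : EuclideanSpace ℝ d) 1 =>
        increment (u q.1.1) (r • (q.2 : EuclideanSpace ℝ d)) q.1.2)
      (((volume.restrict (Ioo 0 T)).prod volume).prod volume.toSphere) := by
  have ha : Measurable fun ω : sphere (0 : EuclideanSpace ℝ d) 1 =>
      FunctionSpaces.Torus.proj (r • (ω : EuclideanSpace ℝ d)) :=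
    FunctionSpaces.Torus.measurable_proj.comp (continuous_subtype_val.const_smul r).measurable
  have h : (fun q : (ℝ × UnitAddTorus d) × sphere (0 : EuclideanSpace ℝ d) 1 =>
        increment (u q.1.1) (r • (q.2 : EuclideanSpace ℝ d)) q.1.2) =
      fun q => u q.1.1 (q.1.2 + FunctionSpaces.Torus.proj (r • (q.2 : EuclideanSpace ℝ d))) - uncurry u q.1 := by
    funext q; rfl
  rw [h]
  exact (aestronglyMeasurable_translate (ν := volume.toSphere) hu ha).sub hu.comp_fst

/-- **Integrability of the kernel-weighted cubic increment functional** on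
`((0,T) × T^d) × ℝ^d`: `((t,x),ξ) ↦ k(|ξ|) Q(ξ̂, δu(t,x;ξ)) ψ(t,x)` is integrable when
`k(|·|) ∈ L¹(ℝ^d)`, `|Q(ω,v)| ≤ C |v|³` for `|ω| ≤ 1`, `u ∈ L³` and `ψ` bounded (translation
invariance of Haar measure on `T^d` and Tonelli). [folklore] -/
theorem integrable_kernel_increment
    (hu : AEStronglyMeasurable (uncurry u) ((volume.restrict (Ioo 0 T)).prod volume))
    (hu3 : ∫⁻ p, ‖uncurry u p‖ₑ ^ 3 ∂((volume.restrict (Ioo 0 T)).prod volume) < ∞)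
    (hψm : AEStronglyMeasurable (uncurry ψ) ((volume.restrict (Ioo 0 T)).prod volume))
    (hψb : ∀ t x, |ψ t x| ≤ Cψ)
    (hQc : Continuous (uncurry Q)) (hCQ : 0 ≤ CQ) (hQ : ∀ ω v, ‖ω‖ ≤ 1 → |Q ω v| ≤ CQ * ‖v‖ ^ 3)
    (hk : Integrable (fun ξ : EuclideanSpace ℝ d => k ‖ξ‖) volume) :
    Integrable
      (fun q : (ℝ × UnitAddTorus d) × EuclideanSpace ℝ d =>
        k ‖q.2‖ * Q (‖q.2‖⁻¹ • q.2) (increment (u q.1.1) q.2 q.1.2) * ψ q.1.1 q.1.2)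
      (((volume.restrict (Ioo 0 T)).prod volume).prod volume) := by
  set μp : Measure (ℝ × UnitAddTorus d) := (volume.restrict (Ioo 0 T)).prod volume with hμp
  have hCψ : 0 ≤ Cψ := (abs_nonneg _).trans (hψb 0 0)
  -- measurability
  have hmeas : AEStronglyMeasurable
      (fun q : (ℝ × UnitAddTorus d) × EuclideanSpace ℝ d =>
        k ‖q.2‖ * Q (‖q.2‖⁻¹ • q.2) (increment (u q.1.1) q.2 q.1.2) * ψ q.1.1 q.1.2)
      (μp.prod volume) := by
    refine (hk.aestronglyMeasurable.comp_snd.mul ?_).mul hψm.comp_fst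
    exact hQc.comp_aestronglyMeasurable
      ((measurable_unitDir.comp measurable_snd).aestronglyMeasurable.prodMk
        (aestronglyMeasurable_increment hu))
  -- the dominating function
  have hg1 : Integrable (fun q : (ℝ × UnitAddTorus d) × EuclideanSpace ℝ d =>
      ‖k ‖q.2‖‖ * ‖u q.1.1 (q.1.2 + FunctionSpaces.Torus.proj q.2)‖ ^ 3) (μp.prod volume) := by
    refine ⟨hk.aestronglyMeasurable.comp_snd.norm.mul
      ((aestronglyMeasurable_translate (ν := volume) hu FunctionSpaces.Torus.measurable_proj).norm.pow 3), ?_⟩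
    simp only [HasFiniteIntegral, enorm_mul, enorm_norm, enorm_norm_pow]
    rw [lintegral_mul_translate_enorm_pow (ν := volume) hu FunctionSpaces.Torus.measurable_proj
      hk.aestronglyMeasurable.enorm 3]
    exact ENNReal.mul_lt_top hk.2 hu3
  have hg2 : Integrable (fun q : (ℝ × UnitAddTorus d) × EuclideanSpace ℝ d =>
      ‖uncurry u q.1‖ ^ 3 * ‖k ‖q.2‖‖) (μp.prod volume) :=
    (integrable_norm_pow_three hu hu3).mul_prod hk.norm
  have hg : Integrable (fun q : (ℝ × UnitAddTorus d) × EuclideanSpace ℝ d =>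
      4 * CQ * Cψ * (‖k ‖q.2‖‖ * ‖u q.1.1 (q.1.2 + FunctionSpaces.Torus.proj q.2)‖ ^ 3 + ‖uncurry u q.1‖ ^ 3 * ‖k ‖q.2‖‖))
      (μp.prod volume) := (hg1.add hg2).const_mul _
  refine hg.mono' hmeas (ae_of_all _ fun q => ?_)
  -- the pointwise bound
  have hQq := hQ (‖q.2‖⁻¹ • q.2) (increment (u q.1.1) q.2 q.1.2) (norm_unitDir_le q.2)
  have hδ := norm_sub_pow_three_le (u q.1.1 (q.1.2 + FunctionSpaces.Torus.proj q.2)) (u q.1.1 q.1.2)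
  rw [Real.norm_eq_abs, abs_mul, abs_mul]
  have h3 : ‖increment (u q.1.1) q.2 q.1.2‖ ^ 3 ≤
      4 * (‖u q.1.1 (q.1.2 + FunctionSpaces.Torus.proj q.2)‖ ^ 3 + ‖uncurry u q.1‖ ^ 3) := hδ
  calc |k ‖q.2‖| * |Q (‖q.2‖⁻¹ • q.2) (increment (u q.1.1) q.2 q.1.2)| * |ψ q.1.1 q.1.2|
      ≤ |k ‖q.2‖| * (CQ * (4 * (‖u q.1.1 (q.1.2 + FunctionSpaces.Torus.proj q.2)‖ ^ 3 + ‖uncurry u q.1‖ ^ 3))) * Cψ := by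
        gcongr
        · exact hQq.trans (by gcongr)
        · exact hψb _ _
    _ = 4 * CQ * Cψ * (‖k ‖q.2‖‖ * ‖u q.1.1 (q.1.2 + FunctionSpaces.Torus.proj q.2)‖ ^ 3 + ‖uncurry u q.1‖ ^ 3 * ‖k ‖q.2‖‖) := by
        rw [Real.norm_eq_abs]; ring

/-- **Integrability of the cubic increment functional on `((0,T) × T^d) × S^{d-1}`** at a fixed
scale `r`: `((t,x),ω) ↦ Q(ω, δu(t,x; rω)) ψ(t,x)`. [folklore] -/
theorem integrable_sphere_increment
    (hu : AEStronglyMeasurable (uncurry u) ((volume.restrict (Ioo 0 T)).prod volume))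
    (hu3 : ∫⁻ p, ‖uncurry u p‖ₑ ^ 3 ∂((volume.restrict (Ioo 0 T)).prod volume) < ∞)
    (hψm : AEStronglyMeasurable (uncurry ψ) ((volume.restrict (Ioo 0 T)).prod volume))
    (hψb : ∀ t x, |ψ t x| ≤ Cψ)
    (hQc : Continuous (uncurry Q)) (hCQ : 0 ≤ CQ) (hQ : ∀ ω v, ‖ω‖ ≤ 1 → |Q ω v| ≤ CQ * ‖v‖ ^ 3)
    (r : ℝ) :
    Integrable
      (fun q : (ℝ × UnitAddTorus d) × sphere (0 : EuclideanSpace ℝ d) 1 =>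
        Q q.2 (increment (u q.1.1) (r • (q.2 : EuclideanSpace ℝ d)) q.1.2) * ψ q.1.1 q.1.2)
      (((volume.restrict (Ioo 0 T)).prod volume).prod volume.toSphere) := by
  set μp : Measure (ℝ × UnitAddTorus d) := (volume.restrict (Ioo 0 T)).prod volume with hμp
  have hCψ : 0 ≤ Cψ := (abs_nonneg _).trans (hψb 0 0)
  have ha : Measurable fun ω : sphere (0 : EuclideanSpace ℝ d) 1 =>
      FunctionSpaces.Torus.proj (r • (ω : EuclideanSpace ℝ d)) :=
    FunctionSpaces.Torus.measurable_proj.comp (continuous_subtype_val.const_smul r).measurable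
  have hmeas : AEStronglyMeasurable
      (fun q : (ℝ × UnitAddTorus d) × sphere (0 : EuclideanSpace ℝ d) 1 =>
        Q q.2 (increment (u q.1.1) (r • (q.2 : EuclideanSpace ℝ d)) q.1.2) * ψ q.1.1 q.1.2)
      (μp.prod volume.toSphere) := by
    refine AEStronglyMeasurable.mul ?_ hψm.comp_fst
    exact hQc.comp_aestronglyMeasurable
      ((continuous_subtype_val.comp continuous_snd).aestronglyMeasurable.prodMk
        (aestronglyMeasurable_increment_sphere hu r))
  have hg1 : Integrable (fun q : (ℝ × UnitAddTorus d) × sphere (0 : EuclideanSpace ℝ d) 1 =>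
      ‖u q.1.1 (q.1.2 + FunctionSpaces.Torus.proj (r • (q.2 : EuclideanSpace ℝ d)))‖ ^ 3) (μp.prod volume.toSphere) := by
    refine ⟨(aestronglyMeasurable_translate (ν := volume.toSphere) hu ha).norm.pow 3, ?_⟩
    simp only [HasFiniteIntegral, enorm_norm_pow]
    have := lintegral_mul_translate_enorm_pow (ν := volume.toSphere) hu ha
      (w := fun _ => 1) aemeasurable_const 3
    simp only [one_mul, lintegral_const] at this
    rw [this]
    exact ENNReal.mul_lt_top (measure_lt_top _ _) hu3
  have hg2 : Integrable (fun q : (ℝ × UnitAddTorus d) × sphere (0 : EuclideanSpace ℝ d) 1 =>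
      ‖uncurry u q.1‖ ^ 3) (μp.prod volume.toSphere) :=
    (integrable_norm_pow_three hu hu3).comp_fst _
  have hg : Integrable (fun q : (ℝ × UnitAddTorus d) × sphere (0 : EuclideanSpace ℝ d) 1 =>
      4 * CQ * Cψ * (‖u q.1.1 (q.1.2 + FunctionSpaces.Torus.proj (r • (q.2 : EuclideanSpace ℝ d)))‖ ^ 3 +
        ‖uncurry u q.1‖ ^ 3)) (μp.prod volume.toSphere) := (hg1.add hg2).const_mul _
  refine hg.mono' hmeas (ae_of_all _ fun q => ?_)
  have hω : ‖(q.2 : EuclideanSpace ℝ d)‖ ≤ 1 := (norm_eq_of_mem_sphere q.2).le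
  have hQq := hQ _ (increment (u q.1.1) (r • (q.2 : EuclideanSpace ℝ d)) q.1.2) hω
  have h3 : ‖increment (u q.1.1) (r • (q.2 : EuclideanSpace ℝ d)) q.1.2‖ ^ 3 ≤
      4 * (‖u q.1.1 (q.1.2 + FunctionSpaces.Torus.proj (r • (q.2 : EuclideanSpace ℝ d)))‖ ^ 3 + ‖uncurry u q.1‖ ^ 3) :=
    norm_sub_pow_three_le _ _
  rw [Real.norm_eq_abs, abs_mul]
  calc |Q q.2 (increment (u q.1.1) (r • (q.2 : EuclideanSpace ℝ d)) q.1.2)| * |ψ q.1.1 q.1.2|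
      ≤ (CQ * (4 * (‖u q.1.1 (q.1.2 + FunctionSpaces.Torus.proj (r • (q.2 : EuclideanSpace ℝ d)))‖ ^ 3 +
          ‖uncurry u q.1‖ ^ 3))) * Cψ := by
        gcongr
        · exact hQq.trans (by gcongr)
        · exact hψb _ _
    _ = _ := by ring

/-- **Kernel/shell identity (Fubini + polar coordinates).** For `k(|·|) ∈ L¹(ℝ^d)`, a cubic form
`Q`, `u ∈ L³((0,T) × T^d)` and bounded `ψ`:
`∫∫ (∫ k(|ξ|) Q(ξ̂, δu(t,x;ξ)) dξ) ψ = |S^{d-1}| ∫_{r>0} r^{d-1} k(r) ∫∫ ⨍_{S^{d-1}} Q(ω, δu(t,x;rω)) dω ψ dr`,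
all space–time integrals over the product measure on `(0,T) × T^d`. [folklore] -/
theorem integral_kernel_increment_eq_polar [Nonempty d]
    (hu : AEStronglyMeasurable (uncurry u) ((volume.restrict (Ioo 0 T)).prod volume))
    (hu3 : ∫⁻ p, ‖uncurry u p‖ₑ ^ 3 ∂((volume.restrict (Ioo 0 T)).prod volume) < ∞)
    (hψm : AEStronglyMeasurable (uncurry ψ) ((volume.restrict (Ioo 0 T)).prod volume))
    (hψb : ∀ t x, |ψ t x| ≤ Cψ)
    (hQc : Continuous (uncurry Q)) (hCQ : 0 ≤ CQ) (hQ : ∀ ω v, ‖ω‖ ≤ 1 → |Q ω v| ≤ CQ * ‖v‖ ^ 3)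
    (hk : Integrable (fun ξ : EuclideanSpace ℝ d => k ‖ξ‖) volume) :
    ∫ p, (∫ ξ, k ‖ξ‖ * Q (‖ξ‖⁻¹ • ξ) (increment (u p.1) ξ p.2)) * ψ p.1 p.2
        ∂((volume.restrict (Ioo 0 T)).prod volume) =
      (volume : Measure (EuclideanSpace ℝ d)).toSphere.real univ *
        ∫ r in Ioi (0 : ℝ), r ^ (Fintype.card d - 1) * k r *
          ∫ p, sphereAvg (fun y => Q y (increment (u p.1) (r • y) p.2)) * ψ p.1 p.2
            ∂((volume.restrict (Ioo 0 T)).prod volume) := by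
  set μp : Measure (ℝ × UnitAddTorus d) := (volume.restrict (Ioo 0 T)).prod volume with hμp
  set F : (ℝ × UnitAddTorus d) × EuclideanSpace ℝ d → ℝ := fun q =>
    k ‖q.2‖ * Q (‖q.2‖⁻¹ • q.2) (increment (u q.1.1) q.2 q.1.2) * ψ q.1.1 q.1.2 with hF
  have hFi : Integrable F (μp.prod volume) :=
    integrable_kernel_increment hu hu3 hψm hψb hQc hCQ hQ hk
  -- Step 1: the left-hand side as an integral over the triple product, then swap
  have h1 : (fun p : ℝ × UnitAddTorus d =>
      (∫ ξ, k ‖ξ‖ * Q (‖ξ‖⁻¹ • ξ) (increment (u p.1) ξ p.2)) * ψ p.1 p.2) =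
      fun p => ∫ ξ, F (p, ξ) := by
    funext p
    rw [← integral_mul_const]
  rw [h1, ← integral_prod _ hFi, integral_prod_symm _ hFi]
  -- Step 2: the inner integral at fixed `ξ`
  have h2 : ∀ ξ : EuclideanSpace ℝ d, ∫ p, F (p, ξ) ∂μp =
      k ‖ξ‖ * ∫ p, Q (‖ξ‖⁻¹ • ξ) (increment (u p.1) ξ p.2) * ψ p.1 p.2 ∂μp := fun ξ => by
    rw [← integral_const_mul]
    refine integral_congr_ae (ae_of_all _ fun p => ?_)
    simp only [hF]
    ring
  have hG : Integrable (fun ξ : EuclideanSpace ℝ d =>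
      k ‖ξ‖ * ∫ p, Q (‖ξ‖⁻¹ • ξ) (increment (u p.1) ξ p.2) * ψ p.1 p.2 ∂μp) volume :=
    hFi.integral_prod_right.congr (ae_of_all _ h2)
  rw [integral_congr_ae (ae_of_all _ h2)]
  -- Step 3: polar coordinates in `ξ`
  rw [Literature.Analysis.FluidPDE.integral_eq_integral_Ioi_sphereIntegral volume hG, ← integral_const_mul]
  refine setIntegral_congr_fun measurableSet_Ioi fun r hr => ?_
  have hr0 : (0 : ℝ) < r := hr
  rw [Literature.Analysis.FluidPDE.sphereIntegral_def, finrank_euclideanSpace, smul_eq_mul]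
  -- on the sphere of radius `r`: `‖rω‖ = r` and `(rω)^ = ω`
  have h3 : ∀ ω : sphere (0 : EuclideanSpace ℝ d) 1,
      k ‖r • (ω : EuclideanSpace ℝ d)‖ *
          ∫ p, Q (‖r • (ω : EuclideanSpace ℝ d)‖⁻¹ • (r • (ω : EuclideanSpace ℝ d)))
            (increment (u p.1) (r • (ω : EuclideanSpace ℝ d)) p.2) * ψ p.1 p.2 ∂μp =
        k r * ∫ p, Q ω (increment (u p.1) (r • (ω : EuclideanSpace ℝ d)) p.2) * ψ p.1 p.2 ∂μp := by
    intro ω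
    rw [Literature.Analysis.FluidPDE.norm_smul_sphere hr0.le, smul_smul, inv_mul_cancel₀ hr0.ne', one_smul]
  rw [integral_congr_ae (ae_of_all _ h3), integral_const_mul]
  -- Step 4: swap `ω` and `(t,x)` and recognise the sphere average
  have hS : Integrable (uncurry fun (ω : sphere (0 : EuclideanSpace ℝ d) 1) (p : ℝ × UnitAddTorus d) =>
      Q ω (increment (u p.1) (r • (ω : EuclideanSpace ℝ d)) p.2) * ψ p.1 p.2)
      (volume.toSphere.prod μp) :=
    (integrable_sphere_increment hu hu3 hψm hψb hQc hCQ hQ r).swap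
  rw [integral_integral_swap hS]
  have h4 : ∀ p : ℝ × UnitAddTorus d,
      ∫ ω : sphere (0 : EuclideanSpace ℝ d) 1,
          Q ω (increment (u p.1) (r • (ω : EuclideanSpace ℝ d)) p.2) * ψ p.1 p.2 ∂volume.toSphere =
        (volume : Measure (EuclideanSpace ℝ d)).toSphere.real univ *
          (sphereAvg (fun y => Q y (increment (u p.1) (r • y) p.2)) * ψ p.1 p.2) := fun p => by
    rw [integral_mul_const,
      integral_sphere_eq_mul_sphereAvg (fun y => Q y (increment (u p.1) (r • y) p.2)), mul_assoc]
  rw [integral_congr_ae (ae_of_all _ h4), integral_const_mul]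
  ring

end Shell


/-! ## Radial functions: gradient, profile integrals, a radial mollifier -/

section Radial

variable {E : Type*} [NormedAddCommGroup E] [InnerProductSpace ℝ E]

/-- The norm is differentiable away from the origin with derivative `v ↦ ⟪ξ/|ξ|, v⟫`. [folklore] -/
theorem hasFDerivAt_norm_of_ne_zero {ξ : E} (hξ : ξ ≠ 0) :
    HasFDerivAt (fun x : E => ‖x‖) (‖ξ‖⁻¹ • innerSL ℝ ξ) ξ := by
  have h1 : HasFDerivAt (fun x : E => ‖x‖ ^ 2) (2 • innerSL ℝ ξ) ξ :=
    (hasStrictFDerivAt_norm_sq ξ).hasFDerivAt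
  have h2 : HasDerivAt (fun y : ℝ => Real.sqrt y) (1 / (2 * Real.sqrt (‖ξ‖ ^ 2))) (‖ξ‖ ^ 2) :=
    Real.hasDerivAt_sqrt (pow_ne_zero 2 (norm_ne_zero_iff.2 hξ))
  have h3 := h2.comp_hasFDerivAt ξ h1
  have heq : ((fun y : ℝ => Real.sqrt y) ∘ fun x : E => ‖x‖ ^ 2) = fun x => ‖x‖ := by
    funext x; exact Real.sqrt_sq (norm_nonneg x)
  have hn : ‖ξ‖ ≠ 0 := norm_ne_zero_iff.2 hξ
  have hderiv : (1 / (2 * Real.sqrt (‖ξ‖ ^ 2))) • (2 • innerSL ℝ ξ) = ‖ξ‖⁻¹ • innerSL ℝ ξ := by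
    ext v
    rw [Real.sqrt_sq (norm_nonneg ξ)]
    simp only [_root_.smul_apply, two_smul, smul_eq_mul, _root_.add_apply]
    field_simp
    ring
  rw [heq, hderiv] at h3
  exact h3

/-- **Gradient of a radial function.** If `χ` is differentiable and spherically symmetric, then
for `ξ ≠ 0`, `⟪∇χ(ξ), v⟫ = X'(|ξ|) ⟪ξ/|ξ|, v⟫` with the profile `X(r) = χ(r e₀)`, `|e₀| = 1`. [folklore] -/
theorem inner_gradient_radial [CompleteSpace E] {χ : E → ℝ} (hχ : Differentiable ℝ χ)
    (hrad : ∀ x y : E, ‖x‖ = ‖y‖ → χ x = χ y) {e₀ : E} (he₀ : ‖e₀‖ = 1) {ξ : E} (hξ : ξ ≠ 0)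
    (v : E) :
    ⟪_root_.gradient χ ξ, v⟫ = deriv (fun r : ℝ => χ (r • e₀)) ‖ξ‖ * ⟪‖ξ‖⁻¹ • ξ, v⟫ := by
  -- `χ = X ∘ ‖·‖`
  have hX : ∀ x : E, χ x = χ (‖x‖ • e₀) := fun x =>
    hrad x _ (by rw [norm_smul, he₀, mul_one, Real.norm_eq_abs, abs_of_nonneg (norm_nonneg _)])
  have hXd : HasDerivAt (fun r : ℝ => χ (r • e₀)) (deriv (fun r : ℝ => χ (r • e₀)) ‖ξ‖) ‖ξ‖ := by
    refine DifferentiableAt.hasDerivAt ?_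
    exact (hχ _).comp _ ((differentiableAt_id).smul_const e₀)
  have hcomp := hXd.comp_hasFDerivAt ξ (hasFDerivAt_norm_of_ne_zero hξ)
  have hfun : ((fun r : ℝ => χ (r • e₀)) ∘ fun x : E => ‖x‖) = χ := by
    funext x; exact (hX x).symm
  rw [hfun] at hcomp
  rw [_root_.gradient, InnerProductSpace.toDual_symm_apply, hcomp.fderiv]
  simp only [_root_.smul_apply, innerSL_apply_apply, smul_eq_mul, real_inner_smul_left]

variable [FiniteDimensional ℝ E] [MeasurableSpace E] [BorelSpace E]

/-- **Radial integration by parts**: for a `C¹` profile `X` vanishing for `r ≥ R > 0` and `n ≥ 1`,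
`∫_{r>0} rⁿ X'(r) dr = −n ∫_{r>0} rⁿ⁻¹ X(r) dr`. [folklore] -/
theorem integral_Ioi_pow_mul_deriv {X : ℝ → ℝ} (hX : ContDiff ℝ 1 X) {R : ℝ} (hR : 0 < R)
    (hsupp : ∀ r, R ≤ r → X r = 0) {n : ℕ} (hn : 1 ≤ n) :
    ∫ r in Ioi (0 : ℝ), r ^ n * deriv X r = -n * ∫ r in Ioi (0 : ℝ), r ^ (n - 1) * X r := by
  have hXd : ∀ r, HasDerivAt X (deriv X r) r := fun r =>
    (hX.differentiable one_ne_zero r).hasDerivAt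
  have hX'c : Continuous (deriv X) := hX.continuous_deriv le_rfl
  have hsupp' : ∀ r, R < r → deriv X r = 0 := fun r hr => by
    have : deriv X r = deriv (fun _ => (0 : ℝ)) r := by
      refine Filter.EventuallyEq.deriv_eq ?_
      filter_upwards [Ioi_mem_nhds hr] with s hs using hsupp s (le_of_lt hs)
    rw [this, deriv_const]
  -- reduce both sides to interval integrals over `(0, R]`
  have h1 : ∫ r in Ioi (0 : ℝ), r ^ n * deriv X r = ∫ r in (0 : ℝ)..R, r ^ n * deriv X r := by
    rw [intervalIntegral.integral_of_le hR.le, ← setIntegral_eq_of_subset_of_forall_sdiff_eq_zero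
      measurableSet_Ioi Ioc_subset_Ioi_self]
    intro r hr
    have hr' : R < r := by
      simp only [Set.mem_sdiff, mem_Ioi, mem_Ioc, not_and, not_le] at hr
      exact hr.2 hr.1
    rw [hsupp' r hr', mul_zero]
  have h2 : ∫ r in Ioi (0 : ℝ), r ^ (n - 1) * X r = ∫ r in (0 : ℝ)..R, r ^ (n - 1) * X r := by
    rw [intervalIntegral.integral_of_le hR.le, ← setIntegral_eq_of_subset_of_forall_sdiff_eq_zero
      measurableSet_Ioi Ioc_subset_Ioi_self]
    intro r hr
    have hr' : R < r := by
      simp only [Set.mem_sdiff, mem_Ioi, mem_Ioc, not_and, not_le] at hr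
      exact hr.2 hr.1
    rw [hsupp r hr'.le, mul_zero]
  rw [h1, h2]
  -- integration by parts on `[0, R]`
  have hu : ∀ r ∈ Set.uIcc (0 : ℝ) R, HasDerivAt (fun r : ℝ => r ^ n) ((n : ℝ) * r ^ (n - 1)) r :=
    fun r _ => hasDerivAt_pow n r
  have hv : ∀ r ∈ Set.uIcc (0 : ℝ) R, HasDerivAt X (deriv X r) r := fun r _ => hXd r
  have hibp := intervalIntegral.integral_mul_deriv_eq_deriv_mul hu hv
    ((continuous_const.mul (continuous_pow _)).intervalIntegrable _ _)
    (hX'c.intervalIntegrable _ _)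
  rw [hibp, hsupp R le_rfl, mul_zero, zero_pow (by omega), zero_mul, sub_zero, zero_sub,
    ← intervalIntegral.integral_neg, ← intervalIntegral.integral_const_mul]
  refine intervalIntegral.integral_congr fun r _ => ?_
  show -((n : ℝ) * r ^ (n - 1) * X r) = -(n : ℝ) * (r ^ (n - 1) * X r)
  ring

variable [Nontrivial E] (μ : Measure E) [μ.IsAddHaarMeasure]

/-- **Unit mass in polar coordinates**: for a radial `χ` with profile `X` and `∫ χ = 1`,
`|S^{d-1}| ∫_{r>0} r^{d-1} X(r) dr = 1` (Mathlib's `integral_fun_norm_addHaar`). [folklore] -/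
theorem toSphere_real_univ_mul_integral_profile {χ : E → ℝ} (hrad : ∀ x y : E, ‖x‖ = ‖y‖ → χ x = χ y)
    {e₀ : E} (he₀ : ‖e₀‖ = 1) (hint : ∫ x, χ x ∂μ = 1) :
    μ.toSphere.real univ * ∫ r in Ioi (0 : ℝ), r ^ (finrank ℝ E - 1) * χ (r • e₀) = 1 := by
  have hX : ∀ x : E, χ x = χ (‖x‖ • e₀) := fun x =>
    hrad x _ (by rw [norm_smul, he₀, mul_one, Real.norm_eq_abs, abs_of_nonneg (norm_nonneg _)])
  have h := integral_fun_norm_addHaar μ (fun r : ℝ => χ (r • e₀))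
  simp only [← hX, hint, smul_eq_mul, nsmul_eq_mul] at h
  rw [Measure.toSphere_real_apply_univ]
  calc (finrank ℝ E : ℝ) * μ.real (ball 0 1) * ∫ r in Ioi (0 : ℝ), r ^ (finrank ℝ E - 1) * χ (r • e₀)
      = (finrank ℝ E : ℝ) * (μ.real (ball 0 1) * ∫ r in Ioi (0 : ℝ), r ^ (finrank ℝ E - 1) * χ (r • e₀)) := by
        ring
    _ = 1 := h.symm

end Radial

/-! ## A radial mollifier on `ℝ^d` -/

section RadialMollifier

open scoped ContDiff

/-- **Radial mollifiers exist**: on `ℝ^d` (`d` nonempty) there is a mollifier in the sense of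
`Fluid.IsMollifier` (smooth, compactly supported, even, nonnegative, unit integral) which is
spherically symmetric and supported in the closed unit ball — e.g. a normalised
`smoothTransition (2 − 2|ξ|²)`. [folklore] -/
theorem exists_isMollifier_radial [Nonempty d] :
    ∃ φ : EuclideanSpace ℝ d → ℝ, FluidPDE.IsMollifier φ ∧ (∀ x y, ‖x‖ = ‖y‖ → φ x = φ y) ∧
      ∀ x, 1 < ‖x‖ → φ x = 0 := by
  set ψ₀ : EuclideanSpace ℝ d → ℝ := fun ξ => Real.smoothTransition (2 - 2 * ‖ξ‖ ^ 2) with hψ₀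
  have hsmooth : ContDiff ℝ ∞ ψ₀ :=
    Real.smoothTransition.contDiff.comp (contDiff_const.sub (contDiff_const.mul (contDiff_norm_sq ℝ)))
  have hnonneg : ∀ ξ, 0 ≤ ψ₀ ξ := fun ξ => Real.smoothTransition.nonneg _
  have hzero : ∀ ξ : EuclideanSpace ℝ d, 1 < ‖ξ‖ → ψ₀ ξ = 0 := fun ξ hξ => by
    refine Real.smoothTransition.zero_of_nonpos ?_
    nlinarith [norm_nonneg ξ]
  have hone : ∀ ξ : EuclideanSpace ℝ d, ‖ξ‖ ≤ 2⁻¹ → ψ₀ ξ = 1 := fun ξ hξ => by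
    refine Real.smoothTransition.one_of_one_le ?_
    nlinarith [norm_nonneg ξ]
  have hsupp : HasCompactSupport ψ₀ := by
    refine HasCompactSupport.intro (isCompact_closedBall (0 : EuclideanSpace ℝ d) 1) fun ξ hξ => ?_
    exact hzero ξ (by simpa [dist_zero_right] using hξ)
  have hcont : Continuous ψ₀ := hsmooth.continuous
  have hint : Integrable ψ₀ volume := hcont.integrable_of_hasCompactSupport hsupp
  have hpos : 0 < ∫ ξ, ψ₀ ξ := by
    rw [integral_pos_iff_support_of_nonneg hnonneg hint]
    have hsub : ball (0 : EuclideanSpace ℝ d) 2⁻¹ ⊆ support ψ₀ := fun ξ hξ => by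
      rw [mem_support, hone ξ (by simpa [dist_zero_right] using (mem_ball.1 hξ).le)]
      exact one_ne_zero
    exact (measure_ball_pos volume (0 : EuclideanSpace ℝ d) (by norm_num)).trans_le
      (measure_mono hsub)
  set c : ℝ := ∫ ξ, ψ₀ ξ with hc
  refine ⟨fun ξ => c⁻¹ * ψ₀ ξ, ⟨contDiff_const.mul hsmooth, hsupp.mul_left, fun ξ => ?_, fun ξ => ?_,
    ?_⟩, fun x y hxy => ?_, fun x hx => ?_⟩
  · simp [hψ₀, norm_neg]
  · exact mul_nonneg (inv_nonneg.2 hpos.le) (hnonneg ξ)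
  · rw [integral_const_mul, inv_mul_cancel₀ hpos.ne']
  · simp [hψ₀, hxy]
  · show c⁻¹ * ψ₀ x = 0
    rw [hzero x hx, mul_zero]

end RadialMollifier


/-! ## The Duchon–Robert integrand for a radial mollifier -/

section DRKernel

/-- If a profile vanishes on `(R, ∞)`, so does its derivative. [folklore] -/
theorem deriv_eq_zero_of_forall_gt {X : ℝ → ℝ} {R r : ℝ} (hX : ∀ s, R < s → X s = 0) (hr : R < r) :
    deriv X r = 0 := by
  have : deriv X r = deriv (fun _ => (0 : ℝ)) r := by
    refine Filter.EventuallyEq.deriv_eq ?_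
    filter_upwards [Ioi_mem_nhds hr] with s hs using hX s hs
  rw [this, deriv_const]

open scoped ContDiff in
/-- **The gradient of a rescaled radial mollifier.** For a smooth radial `φ` with profile
`Φ(r) = φ(r e₀)` and `ε > 0`, `⟪∇φ^ε(ξ), v⟫ = ε^{-d} ε⁻¹ Φ'(|ξ|/ε) ⟪ξ̂, v⟫` for `ξ ≠ 0`. [folklore] -/
theorem inner_gradient_mollifierScale {φ : EuclideanSpace ℝ d → ℝ} (hφ : ContDiff ℝ ∞ φ)
    (hrad : ∀ x y, ‖x‖ = ‖y‖ → φ x = φ y) {e₀ : EuclideanSpace ℝ d} (he₀ : ‖e₀‖ = 1)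
    (ε : ℝ) {ξ : EuclideanSpace ℝ d} (hξ : ξ ≠ 0) (v : EuclideanSpace ℝ d) :
    ⟪_root_.gradient (FluidPDE.mollifierScale ε φ) ξ, v⟫ =
      (ε ^ Fintype.card d)⁻¹ * (ε⁻¹ * deriv (fun r : ℝ => φ (r • e₀)) (ε⁻¹ * ‖ξ‖)) *
        ⟪‖ξ‖⁻¹ • ξ, v⟫ := by
  have hdiff : Differentiable ℝ (FluidPDE.mollifierScale ε φ) := by
    intro x
    exact (differentiableAt_const _).mul
      ((hφ.differentiable (by simp) _).comp x (differentiableAt_id.const_smul ε⁻¹))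
  have hrad' : ∀ x y : EuclideanSpace ℝ d, ‖x‖ = ‖y‖ →
      FluidPDE.mollifierScale ε φ x = FluidPDE.mollifierScale ε φ y := fun x y hxy => by
    rw [FluidPDE.mollifierScale_apply, FluidPDE.mollifierScale_apply, hrad (ε⁻¹ • x) (ε⁻¹ • y)]
    rw [norm_smul, norm_smul, hxy]
  rw [inner_gradient_radial hdiff hrad' he₀ hξ v]
  congr 1
  -- the profile of `φ^ε` is `r ↦ ε^{-d} Φ(r/ε)`
  have hprof : (fun r : ℝ => FluidPDE.mollifierScale ε φ (r • e₀)) =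
      fun r => (ε ^ Fintype.card d)⁻¹ * φ ((ε⁻¹ * r) • e₀) := by
    funext r
    rw [FluidPDE.mollifierScale_apply, smul_smul]
  rw [hprof, deriv_const_mul]
  · congr 1
    have hΦd : ∀ s, HasDerivAt (fun r : ℝ => φ (r • e₀)) (deriv (fun r : ℝ => φ (r • e₀)) s) s :=
      fun s => (((hφ.differentiable (by simp)) _).comp s
        (differentiableAt_id.smul_const e₀)).hasDerivAt
    have hc := (hΦd (ε⁻¹ * ‖ξ‖)).comp ‖ξ‖ ((hasDerivAt_id ‖ξ‖).const_mul ε⁻¹)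
    simp only [mul_one] at hc
    rw [show (fun r : ℝ => φ ((ε⁻¹ * r) • e₀)) = (fun r : ℝ => φ (r • e₀)) ∘ fun r => ε⁻¹ * r from
      rfl, hc.deriv]
    ring
  · exact ((hφ.differentiable (by simp)) _).comp _
      ((differentiableAt_id.const_mul _).smul_const e₀)

open scoped ContDiff in
/-- **The Duchon–Robert integrand in kernel form**: for a smooth radial `φ`, `ε > 0` and every
`ξ` (including `ξ = 0`, where both sides vanish),
`⟪∇φ^ε(ξ), δu⟫ |δu|² = k_ε(|ξ|) · (⟪δu, ξ̂⟫ |δu|²)` with `k_ε(r) = ε^{-d} ε⁻¹ Φ'(r/ε)`. [folklore] -/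
theorem dr_integrand_eq_kernel {φ : EuclideanSpace ℝ d → ℝ} (hφ : ContDiff ℝ ∞ φ)
    (hrad : ∀ x y, ‖x‖ = ‖y‖ → φ x = φ y) {e₀ : EuclideanSpace ℝ d} (he₀ : ‖e₀‖ = 1)
    (ε : ℝ) (w : UnitAddTorus d → EuclideanSpace ℝ d) (x : UnitAddTorus d)
    (ξ : EuclideanSpace ℝ d) :
    ⟪_root_.gradient (FluidPDE.mollifierScale ε φ) ξ, increment w ξ x⟫ * ‖increment w ξ x‖ ^ 2 =
      (ε ^ Fintype.card d)⁻¹ * (ε⁻¹ * deriv (fun r : ℝ => φ (r • e₀)) (ε⁻¹ * ‖ξ‖)) *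
        (⟪increment w ξ x, ‖ξ‖⁻¹ • ξ⟫ * ‖increment w ξ x‖ ^ 2) := by
  by_cases hξ : ξ = 0
  · subst hξ
    simp
  · rw [inner_gradient_mollifierScale hφ hrad he₀ ε hξ, real_inner_comm]
    ring

end DRKernel

/-! ## A dominated-convergence lemma on `(0, ∞)` -/

section DCT

/-- Multiplication by `ε ≠ 0` is quasi measure preserving on `ℝ`. [folklore] -/
theorem quasiMeasurePreserving_mul_left_real {ε : ℝ} (hε : ε ≠ 0) :
    QuasiMeasurePreserving (fun x : ℝ => ε * x) volume volume := by
  refine ⟨measurable_const_mul ε, ?_⟩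
  rw [Real.map_volume_mul_left hε]
  exact Measure.smul_absolutelyContinuous

/-- **Dominated convergence for rescaled pairings.** If `K ∈ L¹(0,∞)` vanishes on `(R,∞)`, `G` is
measurable, bounded by `M` on `(0, δ)`, and `G(ℓ) → L` as `ℓ → 0⁺`, then
`∫_{x>0} K(x) G(εx) dx → (∫_{x>0} K) · L` as `ε → 0⁺`. [folklore] -/
theorem tendsto_integral_Ioi_mul_comp_mul {K G : ℝ → ℝ} {R M δ L : ℝ}
    (hK : IntegrableOn K (Ioi 0)) (hKsupp : ∀ x, R < x → K x = 0) (hR : 0 < R)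
    (hGm : AEStronglyMeasurable G volume) (hδ : 0 < δ)
    (hM : ∀ ℓ ∈ Ioo 0 δ, |G ℓ| ≤ M) (hG : Tendsto G (𝓝[>] 0) (𝓝 L)) :
    Tendsto (fun ε => ∫ x in Ioi 0, K x * G (ε * x)) (𝓝[>] 0)
      (𝓝 ((∫ x in Ioi 0, K x) * L)) := by
  rw [← integral_mul_const]
  have hεpos : ∀ᶠ ε in 𝓝[>] (0 : ℝ), 0 < ε := eventually_mem_nhdsWithin
  have hεsmall : ∀ᶠ ε in 𝓝[>] (0 : ℝ), ε ∈ Ioo 0 (δ / R) := Ioo_mem_nhdsGT (div_pos hδ hR)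
  refine tendsto_integral_filter_of_dominated_convergence (fun x => ‖K x‖ * M) ?_ ?_ ?_ ?_
  · filter_upwards [hεpos] with ε hε
    exact hK.aestronglyMeasurable.mul
      ((hGm.comp_quasiMeasurePreserving (quasiMeasurePreserving_mul_left_real hε.ne')).restrict)
  · filter_upwards [hεsmall] with ε hε
    refine (ae_restrict_mem measurableSet_Ioi).mono fun x hx => ?_
    rw [norm_mul]
    by_cases hxR : R < x
    · rw [hKsupp x hxR]
      simp
    · refine mul_le_mul_of_nonneg_left ?_ (norm_nonneg _)
      rw [Real.norm_eq_abs]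
      refine hM _ ⟨mul_pos hε.1 hx, ?_⟩
      have hxR' : x ≤ R := not_lt.1 hxR
      calc ε * x ≤ ε * R := by gcongr; exact hε.1.le
        _ < δ / R * R := by gcongr; exact hε.2
        _ = δ := div_mul_cancel₀ δ hR.ne'
  · exact hK.norm.mul_const M
  · refine (ae_restrict_mem measurableSet_Ioi).mono fun x hx => ?_
    have hx0 : (0 : ℝ) < x := hx
    have hmul : Tendsto (fun ε : ℝ => ε * x) (𝓝[>] 0) (𝓝[>] 0) := by
      refine tendsto_nhdsWithin_of_tendsto_nhds_of_eventually_within _ ?_ ?_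
      · have : Tendsto (fun ε : ℝ => ε * x) (𝓝 0) (𝓝 (0 * x)) := tendsto_id.mul_const x
        rw [zero_mul] at this
        exact this.mono_left nhdsWithin_le_nhds
      · filter_upwards [self_mem_nhdsWithin] with ε hε using mul_pos hε hx0
    exact (hG.comp hmul).const_mul (K x)

end DCT


/-! ## Measurability in the scale parameter -/

section ScaleMeasurability

variable {T : ℝ} {u : ℝ → UnitAddTorus d → EuclideanSpace ℝ d} {ψ : ℝ → UnitAddTorus d → ℝ}
  {Q : EuclideanSpace ℝ d → EuclideanSpace ℝ d → ℝ} {CQ Cψ : ℝ}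

/-- The surface measure of `S^{d-1}` has positive total mass (`d` nonempty). [folklore] -/
theorem toSphere_real_univ_pos [Nonempty d] :
    0 < (volume : Measure (EuclideanSpace ℝ d)).toSphere.real univ := by
  rw [Measure.toSphere_real_apply_univ, finrank_euclideanSpace]
  refine mul_pos (by exact_mod_cast Fintype.card_pos) ?_
  exact ENNReal.toReal_pos (measure_ball_pos volume _ one_pos).ne' measure_ball_lt_top.ne

/-- **Measurability of shell pairings in the scale.** The map
`ℓ ↦ ∫∫ ⨍_{S^{d-1}} Q(ω, δu(t,x; ℓω)) dω ψ(t,x)` is a.e.-strongly measurable on `ℝ`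
(a parametric integral of a jointly measurable integrand). [folklore] -/
theorem aestronglyMeasurable_integral_sphereAvg [Nonempty d]
    (hu : AEStronglyMeasurable (uncurry u) ((volume.restrict (Ioo 0 T)).prod volume))
    (hu3 : ∫⁻ p, ‖uncurry u p‖ₑ ^ 3 ∂((volume.restrict (Ioo 0 T)).prod volume) < ∞)
    (hψm : AEStronglyMeasurable (uncurry ψ) ((volume.restrict (Ioo 0 T)).prod volume))
    (hψb : ∀ t x, |ψ t x| ≤ Cψ)
    (hQc : Continuous (uncurry Q)) (hCQ : 0 ≤ CQ) (hQ : ∀ ω v, ‖ω‖ ≤ 1 → |Q ω v| ≤ CQ * ‖v‖ ^ 3) :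
    AEStronglyMeasurable (fun ℓ : ℝ =>
      ∫ p, sphereAvg (fun y => Q y (increment (u p.1) (ℓ • y) p.2)) * ψ p.1 p.2
        ∂((volume.restrict (Ioo 0 T)).prod volume)) volume := by
  set μp : Measure (ℝ × UnitAddTorus d) := (volume.restrict (Ioo 0 T)).prod volume with hμp
  set σ : Measure (sphere (0 : EuclideanSpace ℝ d) 1) := volume.toSphere with hσ
  -- the jointly measurable integrand on `ℝ × ((ℝ × T^d) × S^{d-1})`
  set W : ℝ × ((ℝ × UnitAddTorus d) × sphere (0 : EuclideanSpace ℝ d) 1) → ℝ := fun z =>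
    Q z.2.2 (increment (u z.2.1.1) (z.1 • (z.2.2 : EuclideanSpace ℝ d)) z.2.1.2) * ψ z.2.1.1 z.2.1.2
    with hW
  -- the shuffle `(ℓ, (p, ω)) ↦ (p, (ℓ, ω))` is measure preserving
  set e : ℝ × ((ℝ × UnitAddTorus d) × sphere (0 : EuclideanSpace ℝ d) 1) →
      (ℝ × UnitAddTorus d) × (ℝ × sphere (0 : EuclideanSpace ℝ d) 1) :=
    fun z => (z.2.1, (z.1, z.2.2)) with he
  have hemp : MeasurePreserving e (volume.prod (μp.prod σ)) (μp.prod (volume.prod σ)) := by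
    have h1 := (measurePreserving_prodAssoc (volume : Measure ℝ) μp σ).symm
    have h2 : MeasurePreserving (Prod.map Prod.swap id)
        (((volume : Measure ℝ).prod μp).prod σ) ((μp.prod (volume : Measure ℝ)).prod σ) :=
      (measurePreserving_swap).prod (MeasurePreserving.id σ)
    have h3 := measurePreserving_prodAssoc μp (volume : Measure ℝ) σ
    have := h3.comp (h2.comp h1)
    convert this using 1
    funext z
    rfl
  have ha : Measurable fun b : ℝ × sphere (0 : EuclideanSpace ℝ d) 1 =>
      FunctionSpaces.Torus.proj (b.1 • (b.2 : EuclideanSpace ℝ d)) :=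
    FunctionSpaces.Torus.measurable_proj.comp (measurable_fst.smul (measurable_subtype_coe.comp measurable_snd))
  have hshift : AEStronglyMeasurable
      (fun z : ℝ × ((ℝ × UnitAddTorus d) × sphere (0 : EuclideanSpace ℝ d) 1) =>
        u z.2.1.1 (z.2.1.2 + FunctionSpaces.Torus.proj (z.1 • (z.2.2 : EuclideanSpace ℝ d))))
      (volume.prod (μp.prod σ)) := by
    have h := (aestronglyMeasurable_translate (ν := volume.prod σ) hu ha).comp_measurePreserving hemp
    exact h
  have hincr : AEStronglyMeasurable
      (fun z : ℝ × ((ℝ × UnitAddTorus d) × sphere (0 : EuclideanSpace ℝ d) 1) =>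
        increment (u z.2.1.1) (z.1 • (z.2.2 : EuclideanSpace ℝ d)) z.2.1.2)
      (volume.prod (μp.prod σ)) := by
    have h2 : AEStronglyMeasurable
        (fun z : ℝ × ((ℝ × UnitAddTorus d) × sphere (0 : EuclideanSpace ℝ d) 1) =>
          uncurry u z.2.1) (volume.prod (μp.prod σ)) :=
      (hu.comp_fst (ν := σ)).comp_snd (μ := volume)
    have heq : (fun z : ℝ × ((ℝ × UnitAddTorus d) × sphere (0 : EuclideanSpace ℝ d) 1) =>
        increment (u z.2.1.1) (z.1 • (z.2.2 : EuclideanSpace ℝ d)) z.2.1.2) =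
        fun z => u z.2.1.1 (z.2.1.2 + FunctionSpaces.Torus.proj (z.1 • (z.2.2 : EuclideanSpace ℝ d))) - uncurry u z.2.1 := by
      funext z; rfl
    rw [heq]
    exact hshift.sub h2
  have hWm : AEStronglyMeasurable W (volume.prod (μp.prod σ)) := by
    refine AEStronglyMeasurable.mul ?_ ((hψm.comp_fst (ν := σ)).comp_snd (μ := volume))
    exact hQc.comp_aestronglyMeasurable
      (((continuous_subtype_val.comp (continuous_snd.comp continuous_snd)).aestronglyMeasurable).prodMk
        hincr)
  have hJ := hWm.integral_prod_right'
  -- identify the parametric integral with the shell pairing, up to the constant `|S^{d-1}|`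
  have hc := (toSphere_real_univ_pos (d := d)).ne'
  have hid : ∀ ℓ : ℝ, ∫ p, sphereAvg (fun y => Q y (increment (u p.1) (ℓ • y) p.2)) * ψ p.1 p.2 ∂μp =
      ((volume : Measure (EuclideanSpace ℝ d)).toSphere.real univ)⁻¹ * ∫ y, W (ℓ, y) ∂(μp.prod σ) := by
    intro ℓ
    have hS := integrable_sphere_increment hu hu3 hψm hψb hQc hCQ hQ ℓ
    rw [integral_prod _ hS]
    have h4 : ∀ p : ℝ × UnitAddTorus d,
        ∫ ω : sphere (0 : EuclideanSpace ℝ d) 1,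
            Q ω (increment (u p.1) (ℓ • (ω : EuclideanSpace ℝ d)) p.2) * ψ p.1 p.2 ∂σ =
          (volume : Measure (EuclideanSpace ℝ d)).toSphere.real univ *
            (sphereAvg (fun y => Q y (increment (u p.1) (ℓ • y) p.2)) * ψ p.1 p.2) := fun p => by
      rw [integral_mul_const,
        integral_sphere_eq_mul_sphereAvg (fun y => Q y (increment (u p.1) (ℓ • y) p.2)), mul_assoc]
    rw [integral_congr_ae (ae_of_all _ h4), integral_const_mul, ← mul_assoc, inv_mul_cancel₀ hc,
      one_mul]
  simp only [hid]
  exact hJ.const_mul _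

end ScaleMeasurability

/-! ## Test functions: measurability and bounds -/

section TestFunction

variable {T : ℝ} {ψ : ℝ → UnitAddTorus d → ℝ}

/-- A space–time test function is jointly continuous. [folklore] -/
theorem _root_.Literature.Analysis.FunctionSpaces.Torus.IsSpaceTimeTestIoo.continuous_uncurry (hψ : FunctionSpaces.Torus.IsSpaceTimeTestIoo T ψ) :
    Continuous (uncurry ψ) :=
  FunctionSpaces.Torus.continuous_uncurry_of_continuous_stLift hψ.1.1.continuous

/-- A space–time test function supported in `(0, T)` is bounded on all of `ℝ × T^d`. [folklore] -/
theorem _root_.Literature.Analysis.FunctionSpaces.Torus.IsSpaceTimeTestIoo.exists_abs_le (hψ : FunctionSpaces.Torus.IsSpaceTimeTestIoo T ψ) :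
    ∃ C : ℝ, ∀ t x, |ψ t x| ≤ C := by
  obtain ⟨⟨hs, T', hT', hT⟩, ε, hε, h0⟩ := hψ
  obtain ⟨C, hC⟩ := FunctionSpaces.Torus.exists_norm_le_of_continuousOn_of_isCompact (u := ψ) (S := univ)
    hs.continuous.continuousOn (isCompact_Icc (a := 0) (b := T)) (subset_univ _)
  refine ⟨max C 0, fun t x => ?_⟩
  by_cases ht : t ∈ Icc 0 T
  · exact (Real.norm_eq_abs _ ▸ hC t ht x).trans (le_max_left _ _)
  · have hz : ψ t = 0 := by
      simp only [mem_Icc, not_and_or, not_le] at ht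
      rcases ht with ht | ht
      · exact h0 t (ht.le.trans hε.le)
      · exact hT t (hT'.le.trans ht.le)
    simp [hz]

end TestFunction


/-! ## The conditional 4/3 law -/

section FourThirds

variable {T : ℝ} {u : ℝ → UnitAddTorus d → EuclideanSpace ℝ d}

/-- Product-measure form of the joint measurability recorded by the weak solution classes. [folklore] -/
theorem aestronglyMeasurable_uncurry_prod_of_stLift_Ioo
    (hum : AEStronglyMeasurable (FunctionSpaces.Torus.stLift u) (volume.restrict (Ioo 0 T ×ˢ univ))) :
    AEStronglyMeasurable (uncurry u) ((volume.restrict (Ioo 0 T)).prod volume) := by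
  have h := FunctionSpaces.Torus.aestronglyMeasurable_uncurry_of_stLift_restrict hum
  rwa [Measure.volume_eq_prod, ← Measure.prod_restrict, Measure.restrict_univ] at h

/-- Product-measure form of the `L³` hypothesis (Tonelli). [folklore] -/
theorem lintegral_prod_enorm_pow_three_lt_top
    (hu : AEStronglyMeasurable (uncurry u) ((volume.restrict (Ioo 0 T)).prod volume))
    (hu3 : ∫⁻ t in Ioo 0 T, ∫⁻ x, ‖u t x‖ₑ ^ (3 : ℕ) < ∞) :
    ∫⁻ p, ‖uncurry u p‖ₑ ^ 3 ∂((volume.restrict (Ioo 0 T)).prod volume) < ∞ := by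
  rw [lintegral_prod _ (hu.enorm.pow_const 3)]
  exact hu3

/-- From a one-sided limit at `0⁺`, a bound on a small interval `(0, δ)`. [folklore] -/
theorem exists_abs_le_of_tendsto_nhdsGT {G : ℝ → ℝ} {L : ℝ} (hG : Tendsto G (𝓝[>] 0) (𝓝 L)) :
    ∃ δ > 0, ∃ M, ∀ ℓ ∈ Ioo 0 δ, |G ℓ| ≤ M := by
  have hev : ∀ᶠ ℓ in 𝓝[>] (0 : ℝ), |G ℓ| ≤ |L| + 1 := by
    filter_upwards [(Metric.tendsto_nhds.1 hG) 1 one_pos] with ℓ hℓ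
    rw [Real.dist_eq] at hℓ
    calc |G ℓ| = |(G ℓ - L) + L| := by ring_nf
      _ ≤ |G ℓ - L| + |L| := abs_add_le _ _
      _ ≤ |L| + 1 := by linarith
  obtain ⟨δ, hδ, hsub⟩ := mem_nhdsGT_iff_exists_Ioo_subset.1 hev
  exact ⟨δ, hδ, |L| + 1, fun ℓ hℓ => hsub hℓ⟩

/-- **The conditional 4/3 law in dimension `d`** (Duchon–Robert 2000, §5; Eyink 2003, §1,
(1.5)–(1.7)): if `u ∈ L³((0,T) × T^d)` (jointly measurable) has Duchon–Robert defect `D`, and for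
a test function `ψ` the shell pairing `∫∫ ℓ⁻¹ ⟨δu_L |δu|²⟩_{ang}(ℓ) ψ` converges to `S ψ` as
`ℓ → 0⁺`, then `S ψ = −(4/d) D ψ`. No Euler equation is needed: for a *radial* mollifier the
Duchon–Robert flux is an average of shell pairings (polar coordinates), and `D_ε(u) → D(u)` is the
definition of the defect. [cite: Eyink2003, §1 (1.5)–(1.7)] -/
theorem HasDuchonRobertDefect.eq_of_tendsto_energyFlux [Nonempty d] {D S : STFunctional d}
    (h : HasDuchonRobertDefect T u D)
    (hum : AEStronglyMeasurable (FunctionSpaces.Torus.stLift u) (volume.restrict (Ioo 0 T ×ˢ univ)))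
    (hu3 : ∫⁻ t in Ioo 0 T, ∫⁻ x, ‖u t x‖ₑ ^ (3 : ℕ) < ∞)
    {ψ : ℝ → UnitAddTorus d → ℝ} (hψ : FunctionSpaces.Torus.IsSpaceTimeTestIoo T ψ)
    (hS : Tendsto (fun ℓ => ∫ t in Ioo 0 T, ∫ x, ℓ⁻¹ * energyFluxSphereAvg (u t) ℓ x * ψ t x)
      (𝓝[>] 0) (𝓝 (S ψ))) :
    S ψ = -fourThirdsConst d * D ψ := by
  -- product-measure form of the hypotheses
  set μp : Measure (ℝ × UnitAddTorus d) := (volume.restrict (Ioo 0 T)).prod volume with hμp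
  have hu : AEStronglyMeasurable (uncurry u) μp := aestronglyMeasurable_uncurry_prod_of_stLift_Ioo hum
  have hu3' : ∫⁻ p, ‖uncurry u p‖ₑ ^ 3 ∂μp < ∞ := lintegral_prod_enorm_pow_three_lt_top hu hu3
  have hψm : AEStronglyMeasurable (uncurry ψ) μp := hψ.continuous_uncurry.aestronglyMeasurable
  obtain ⟨Cψ, hψb⟩ := hψ.exists_abs_le
  -- the cubic form of the 4/3 law
  set Q : EuclideanSpace ℝ d → EuclideanSpace ℝ d → ℝ := fun ω v => ⟪v, ω⟫ * ‖v‖ ^ 2 with hQdef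
  have hQc : Continuous (uncurry Q) :=
    (continuous_snd.inner continuous_fst).mul (continuous_snd.norm.pow 2)
  have hQ : ∀ ω v, ‖ω‖ ≤ 1 → |Q ω v| ≤ 1 * ‖v‖ ^ 3 := fun ω v hω => by
    rw [one_mul, hQdef, abs_mul, abs_of_nonneg (pow_nonneg (norm_nonneg v) 2)]
    calc |⟪v, ω⟫| * ‖v‖ ^ 2 ≤ ‖v‖ * ‖ω‖ * ‖v‖ ^ 2 := by
          gcongr; exact abs_real_inner_le_norm v ω
      _ ≤ ‖v‖ * 1 * ‖v‖ ^ 2 := by gcongr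
      _ = ‖v‖ ^ 3 := by ring
  -- a radial mollifier, its profile and the surface area
  obtain ⟨φ, hφ, hrad, hφsupp⟩ := exists_isMollifier_radial (d := d)
  obtain ⟨e₀, he₀⟩ : ∃ e : EuclideanSpace ℝ d, ‖e‖ = 1 := by
    classical
    obtain ⟨i⟩ := ‹Nonempty d›
    exact ⟨EuclideanSpace.single i 1, by simp⟩
  set Φ : ℝ → ℝ := fun r => φ (r • e₀) with hΦ
  have hΦsmooth : ContDiff ℝ 1 Φ := (hφ.1.of_le (by simp)).comp (contDiff_id.smul contDiff_const)
  have hΦsupp : ∀ r, 1 < r → Φ r = 0 := fun r hr =>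
    hφsupp _ (by rw [norm_smul, he₀, mul_one, Real.norm_eq_abs]; exact hr.trans_le (le_abs_self r))
  have hΦ'supp : ∀ r, 1 < r → deriv Φ r = 0 := fun r hr => deriv_eq_zero_of_forall_gt hΦsupp hr
  have hΦ'c : Continuous (deriv Φ) := hΦsmooth.continuous_deriv le_rfl
  set n : ℕ := Fintype.card d with hndef
  have hn : 1 ≤ n := Fintype.card_pos
  set c : ℝ := (volume : Measure (EuclideanSpace ℝ d)).toSphere.real univ with hcdef
  have hc : 0 < c := toSphere_real_univ_pos
  -- the shell pairing in product form
  set I : ℝ → ℝ := fun r => ∫ p, energyFluxSphereAvg (u p.1) r p.2 * ψ p.1 p.2 ∂μp with hI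
  have hIm : AEStronglyMeasurable I volume :=
    aestronglyMeasurable_integral_sphereAvg hu hu3' hψm hψb hQc zero_le_one hQ
  set G : ℝ → ℝ := fun ℓ => ℓ⁻¹ * I ℓ with hGdef
  have hGm : AEStronglyMeasurable G volume := measurable_inv.aestronglyMeasurable.mul hIm
  have hGiter : ∀ ℓ, ∫ t in Ioo 0 T, ∫ x, ℓ⁻¹ * energyFluxSphereAvg (u t) ℓ x * ψ t x = G ℓ := by
    intro ℓ
    have hS' := integrable_sphere_increment hu hu3' hψm hψb hQc zero_le_one hQ ℓ
    have hint : Integrable (fun p : ℝ × UnitAddTorus d =>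
        energyFluxSphereAvg (u p.1) ℓ p.2 * ψ p.1 p.2) μp := by
      have h1 := hS'.integral_prod_left
      have h2 : ∀ p : ℝ × UnitAddTorus d,
          ∫ ω : sphere (0 : EuclideanSpace ℝ d) 1,
              Q ω (increment (u p.1) (ℓ • (ω : EuclideanSpace ℝ d)) p.2) * ψ p.1 p.2 ∂volume.toSphere =
            c * (energyFluxSphereAvg (u p.1) ℓ p.2 * ψ p.1 p.2) := fun p => by
        rw [integral_mul_const,
          integral_sphere_eq_mul_sphereAvg (fun y => Q y (increment (u p.1) (ℓ • y) p.2)), mul_assoc]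
        rfl
      refine ((h1.congr (ae_of_all _ h2)).const_mul c⁻¹).congr (ae_of_all _ fun p => ?_)
      simp only
      rw [← mul_assoc, inv_mul_cancel₀ hc.ne', one_mul]
    have e1 : ∫ t in Ioo 0 T, ∫ x, ℓ⁻¹ * (energyFluxSphereAvg (u t) ℓ x * ψ t x) =
        ∫ p, ℓ⁻¹ * (energyFluxSphereAvg (u p.1) ℓ p.2 * ψ p.1 p.2) ∂μp :=
      (integral_prod _ (hint.const_mul ℓ⁻¹)).symm
    simp only [hGdef, hI, mul_assoc]
    rw [e1, integral_const_mul]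
  have hGlim : Tendsto G (𝓝[>] 0) (𝓝 (S ψ)) := (tendsto_congr hGiter).1 hS
  obtain ⟨δ, hδ, M, hM⟩ := exists_abs_le_of_tendsto_nhdsGT hGlim
  -- the rescaled kernel `k_ε(r) = ε^{-d} ε⁻¹ Φ'(r/ε)`
  set kε : ℝ → ℝ → ℝ := fun ε r => (ε ^ n)⁻¹ * (ε⁻¹ * deriv Φ (ε⁻¹ * r)) with hkε
  have hkcont : ∀ ε, Continuous (kε ε) := fun ε =>
    continuous_const.mul (continuous_const.mul (hΦ'c.comp (continuous_const.mul continuous_id)))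
  have hksupp : ∀ ε, 0 < ε → ∀ r, ε < r → kε ε r = 0 := fun ε hε r hr => by
    simp only [hkε]
    rw [hΦ'supp _ (by rw [← div_eq_inv_mul, one_lt_div hε]; exact hr), mul_zero, mul_zero]
  have hkint : ∀ ε, 0 < ε → Integrable (fun ξ : EuclideanSpace ℝ d => kε ε ‖ξ‖) volume := by
    intro ε hε
    refine ((hkcont ε).comp continuous_norm).integrable_of_hasCompactSupport ?_
    refine HasCompactSupport.intro (isCompact_closedBall (0 : EuclideanSpace ℝ d) ε) fun ξ hξ => ?_
    exact hksupp ε hε ‖ξ‖ (by simpa [dist_zero_right] using hξ)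
  -- Step A: for `ε > 0` the Duchon–Robert pairing is a rescaled average of shell pairings
  have hA : ∀ ε, 0 < ε → ∫ t in Ioo 0 T, ∫ x, duchonRobertApprox φ ε (u t) x * ψ t x =
      4⁻¹ * c * ∫ x in Ioi (0 : ℝ), x ^ n * deriv Φ x * G (ε * x) := by
    intro ε hε
    -- (A1) the flux in kernel form
    have hDR : ∀ (t : ℝ) (x : UnitAddTorus d), duchonRobertApprox φ ε (u t) x =
        4⁻¹ * ∫ ξ, kε ε ‖ξ‖ * Q (‖ξ‖⁻¹ • ξ) (increment (u t) ξ x) := by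
      intro t x
      rw [duchonRobertApprox]
      congr 1
      refine integral_congr_ae (ae_of_all _ fun ξ => ?_)
      exact dr_integrand_eq_kernel hφ.1 hrad he₀ ε (u t) x ξ
    -- (A2) iterated pairing = product pairing
    have hF := integrable_kernel_increment hu hu3' hψm hψb hQc zero_le_one hQ (hkint ε hε)
    have hmarg : Integrable (fun p : ℝ × UnitAddTorus d =>
        (∫ ξ, kε ε ‖ξ‖ * Q (‖ξ‖⁻¹ • ξ) (increment (u p.1) ξ p.2)) * ψ p.1 p.2) μp := by
      refine hF.integral_prod_left.congr (ae_of_all _ fun p => ?_)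
      simp only
      rw [← integral_mul_const]
    have hpt : (fun t => ∫ x, duchonRobertApprox φ ε (u t) x * ψ t x) = fun t =>
        4⁻¹ * ∫ x, (∫ ξ, kε ε ‖ξ‖ * Q (‖ξ‖⁻¹ • ξ) (increment (u t) ξ x)) * ψ t x := by
      funext t
      rw [← integral_const_mul]
      refine integral_congr_ae (ae_of_all _ fun x => ?_)
      simp only
      rw [hDR t x, mul_assoc]
    have e1 : ∫ t in Ioo 0 T, ∫ x, (∫ ξ, kε ε ‖ξ‖ * Q (‖ξ‖⁻¹ • ξ) (increment (u t) ξ x)) * ψ t x =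
        ∫ p, (∫ ξ, kε ε ‖ξ‖ * Q (‖ξ‖⁻¹ • ξ) (increment (u p.1) ξ p.2)) * ψ p.1 p.2 ∂μp :=
      (integral_prod _ hmarg).symm
    rw [hpt, integral_const_mul, e1,
      integral_kernel_increment_eq_polar hu hu3' hψm hψb hQc zero_le_one hQ (hkint ε hε)]
    -- (A3) the substitution `r = ε x`
    have hsub := integral_comp_mul_left_Ioi (fun r => r ^ (n - 1) * kε ε r * I r) 0 hε
    rw [mul_zero] at hsub
    have e2 : ∫ r in Ioi (0 : ℝ), r ^ (n - 1) * kε ε r * I r =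
        ε * ∫ x in Ioi (0 : ℝ), (ε * x) ^ (n - 1) * kε ε (ε * x) * I (ε * x) := by
      rw [hsub, smul_eq_mul, ← mul_assoc, mul_inv_cancel₀ hε.ne', one_mul]
    have e3 : ∫ r in Ioi (0 : ℝ), r ^ (Fintype.card d - 1) * kε ε r *
          ∫ p, sphereAvg (fun y => Q y (increment (u p.1) (r • y) p.2)) * ψ p.1 p.2 ∂μp =
        ∫ r in Ioi (0 : ℝ), r ^ (n - 1) * kε ε r * I r := rfl
    rw [e3, e2, ← integral_const_mul ε, ← integral_const_mul c, ← integral_const_mul 4⁻¹,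
      ← integral_const_mul (4⁻¹ * c)]
    refine setIntegral_congr_fun measurableSet_Ioi fun x hx => ?_
    have hx0 : (0 : ℝ) < x := hx
    simp only [hkε, hGdef]
    have hεn : ε ^ n = ε ^ (n - 1) * ε := (pow_sub_one_mul (by omega) ε).symm
    have hxn : x ^ n = x ^ (n - 1) * x := (pow_sub_one_mul (by omega) x).symm
    rw [show ε⁻¹ * (ε * x) = x by field_simp, mul_pow, hεn, hxn]
    field_simp
  -- Step B: the two limits
  have hlimA : Tendsto (fun ε => ∫ t in Ioo 0 T, ∫ x, duchonRobertApprox φ ε (u t) x * ψ t x)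
      (𝓝[>] 0) (𝓝 (D ψ)) := h φ hφ ψ hψ
  have hKc : Continuous fun x : ℝ => x ^ n * deriv Φ x := (continuous_pow n).mul hΦ'c
  have hKsupp : ∀ x : ℝ, 1 < x → x ^ n * deriv Φ x = 0 := fun x hx => by
    rw [hΦ'supp x hx, mul_zero]
  have hKint : IntegrableOn (fun x : ℝ => x ^ n * deriv Φ x) (Ioi 0) := by
    refine (hKc.integrable_of_hasCompactSupport ?_).integrableOn
    refine HasCompactSupport.intro (isCompact_Icc (a := -1) (b := 1)) fun x hx => ?_
    simp only [mem_Icc, not_and_or, not_le] at hx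
    rcases hx with hx | hx
    · have : deriv Φ x = 0 := by
        have hΦneg : ∀ s, s < -1 → Φ s = 0 := fun s hs =>
          hφsupp _ (by rw [norm_smul, he₀, mul_one, Real.norm_eq_abs, abs_of_neg (by linarith)]; linarith)
        have : deriv Φ x = deriv (fun _ => (0 : ℝ)) x := by
          refine Filter.EventuallyEq.deriv_eq ?_
          filter_upwards [Iio_mem_nhds hx] with s hs using hΦneg s hs
        rw [this, deriv_const]
      rw [this, mul_zero]
    · exact hKsupp x hx
  have hlimB := tendsto_integral_Ioi_mul_comp_mul hKint hKsupp one_pos hGm hδ hM hGlim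
  have hlimA' : Tendsto (fun ε => ∫ t in Ioo 0 T, ∫ x, duchonRobertApprox φ ε (u t) x * ψ t x)
      (𝓝[>] 0) (𝓝 (4⁻¹ * c * ((∫ x in Ioi (0 : ℝ), x ^ n * deriv Φ x) * S ψ))) := by
    refine (hlimB.const_mul (4⁻¹ * c)).congr' ?_
    filter_upwards [self_mem_nhdsWithin] with ε hε using (hA ε hε).symm
  have hDeq := tendsto_nhds_unique hlimA hlimA'
  -- Step C: the kernel integrals `∫ xⁿ Φ' = −n ∫ xⁿ⁻¹ Φ` and `|S^{d-1}| ∫ xⁿ⁻¹ Φ = 1`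
  have hK1 : ∫ x in Ioi (0 : ℝ), x ^ n * deriv Φ x = -n * ∫ x in Ioi (0 : ℝ), x ^ (n - 1) * Φ x :=
    integral_Ioi_pow_mul_deriv hΦsmooth (R := 2) two_pos (fun r hr => hΦsupp r (by linarith)) hn
  have hK2 : c * ∫ x in Ioi (0 : ℝ), x ^ (n - 1) * Φ x = 1 := by
    have := toSphere_real_univ_mul_integral_profile volume hrad he₀ hφ.2.2.2.2
    rwa [finrank_euclideanSpace] at this
  rw [hK1] at hDeq
  have hfinal : D ψ = -((n : ℝ) / 4) * S ψ := by
    rw [hDeq]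
    calc 4⁻¹ * c * (-(n : ℝ) * (∫ x in Ioi (0 : ℝ), x ^ (n - 1) * Φ x) * S ψ)
        = -((n : ℝ) / 4) * (c * ∫ x in Ioi (0 : ℝ), x ^ (n - 1) * Φ x) * S ψ := by ring
      _ = -((n : ℝ) / 4) * S ψ := by rw [hK2, mul_one]
  have hn0 : (n : ℝ) ≠ 0 := by exact_mod_cast (by omega : n ≠ 0)
  rw [fourThirdsConst, hfinal]
  field_simp
  ring

/-- **The 4/3 law from the existence of the shell limits** (Duchon–Robert 2000, §5; Eyink 2003,
§1 (1.7)): if the shell pairings converge for every test function, to `S ψ`, then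
`Torus.HasFourThirdsLaw T u D` holds (and `S = −(4/d) D` on test functions). [cite: Eyink2003, §1 (1.5)–(1.7)] -/
theorem HasDuchonRobertDefect.hasFourThirdsLaw_of_tendsto [Nonempty d] {D S : STFunctional d}
    (h : HasDuchonRobertDefect T u D)
    (hum : AEStronglyMeasurable (FunctionSpaces.Torus.stLift u) (volume.restrict (Ioo 0 T ×ˢ univ)))
    (hu3 : ∫⁻ t in Ioo 0 T, ∫⁻ x, ‖u t x‖ₑ ^ (3 : ℕ) < ∞)
    (hS : ∀ ψ : ℝ → UnitAddTorus d → ℝ, FunctionSpaces.Torus.IsSpaceTimeTestIoo T ψ →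
      Tendsto (fun ℓ => ∫ t in Ioo 0 T, ∫ x, ℓ⁻¹ * energyFluxSphereAvg (u t) ℓ x * ψ t x)
        (𝓝[>] 0) (𝓝 (S ψ))) :
    HasFourThirdsLaw T u D := by
  intro ψ hψ
  rw [← h.eq_of_tendsto_energyFlux hum hu3 hψ (hS ψ hψ)]
  exact hS ψ hψ

end FourThirds

end Literature.Analysis.FluidPDE.Torus
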